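import Summits.Ventures.GridStability.Models.DroopQVDeflation
import Summits.Ventures.GridStability.Models.DroopQVData
import Literature.Computation.Certificates.Data

/-!
# GridStability/Models/DroopQVDeflateRows — list-row infrastructure for deflation-lane POINT certificates of the droop+QV model at any `n` (kernel-evaluable `H = S(−J′) + (S(−J′))ᵀ − 2r₀S − δ·1` rows; explicit entries of the ℚ-twin Jacobian)

Cell `gridfusion` (LADDER-GRIDFUSION, APEX LINE rung G3.b; seat gridfusion-model-8 (g2); infrastructure for the `n = 10` RATE cell of the
droop+QV scaling census, `Models/NE39DroopQVDeflate.lean`). The deflation lane (`Models/DroopQVDeflation.lean`, p530169/p532375: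
`DroopMicrogrid.eig_re_lt_neg_of_deflate`) consumes two PSD facts about `S` and `H = S(−J′) + (S(−J′))ᵀ − 2r₀S` for the deflated Jacobian
`J′ = jacMatrix (θ*, V*) + r ζᵀ`. At `n = 3` (`Models/WSCC9DroopQVLossyDeflate.lean`) `H` is certified by a direct integer Gram certificate whose
literal the kernel re-derives from `S` and `J′` with `Matrix.mul`; at `n = 10` the exact `H` has ≈ 106-digit heights and `900` entries, so the
certificate of record is lit-5's ROUNDED TWIN [cite: Rump1999VerifiedLargeSystems, §4 Algorithm 4.1 step 7] (`PsdRoundedTwin.lean`), whose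
closeness check reads `H` as `List (List ℚ)` rows. This file supplies:
* §1 `DroopQVData.jacQx` — the ℚ-twin Jacobian `jacQ` (p532782) with its nine blocks written ENTRYWISE (no `Matrix.mul` by diagonal matrices), and
  `jacQ_eq_jacQx`; the kernel evaluates `jacQx` entries directly from the instance data (one list sum per diagonal entry);
* §2 `DeflRows.lyapRows n r₀ δ S J` — computable rows with entry `(i, j) = −Σ_k S_ik J_kj − Σ_k S_jk J_ki − 2r₀ S_ij − δ[i = j]` built from
  `List.finRange`, and the ONCE-PROVED bridge `DeflRows.matrixOfRows_lyapRows`: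
  `matrixOfRows n n (lyapRows n r₀ δ S J) = M_S (−M_J) + (M_S (−M_J))ᵀ − (2r₀)·M_S − δ·1` (`M_X = matrixOfRows n n X`) — so an instance file
  evaluates `H − δ·1` inside ONE `decide` (the twin's closeness check) and never states `H` as a literal.
THREE COLUMNS. CERTIFIED (kernel): list/matrix algebra only; no instance, no parameter, no certificate. No sentence of this file says a grid,
a microgrid or a converter is stable.
-/

namespace Summit.Ventures.GridStability.Models

open Matrix Literature.Computation.Certificates

/-! ## §1 Entrywise form of the ℚ-twin Jacobian -/

namespace DroopQVData

variable {n : ℕ} (d : DroopQVData n)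

/-- The ℚ-twin Jacobian `jacQ` with its nine blocks written entrywise (`Λ^P_i = k_P/τ_P`, `Λ^Q_i = k_Q/τ_Q`):
`[[0, 1, 0], [−Λ^P ∂P/∂θ, −1/τ_P, −Λ^P ∂P/∂V], [−Λ^Q ∂Q/∂θ, 0, −(1/τ_Q)(1 + k_Q ∂Q/∂V)]]`. [folklore] -/
def jacQx : Matrix (Fin (n + 1) ⊕ (Fin (n + 1) ⊕ Fin (n + 1))) (Fin (n + 1) ⊕ (Fin (n + 1) ⊕ Fin (n + 1))) ℚ := fun a b =>
  match a, b with
  | Sum.inl _, Sum.inl _ => 0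
  | Sum.inl i, Sum.inr (Sum.inl j) => if i = j then 1 else 0
  | Sum.inl _, Sum.inr (Sum.inr _) => 0
  | Sum.inr (Sum.inl i), Sum.inl j => -(d.kP i / d.τP i * d.PθQ i j)
  | Sum.inr (Sum.inl i), Sum.inr (Sum.inl j) => if i = j then -(1 / d.τP i) else 0
  | Sum.inr (Sum.inl i), Sum.inr (Sum.inr j) => -(d.kP i / d.τP i * d.PVQ i j)
  | Sum.inr (Sum.inr i), Sum.inl j => -(d.kQ i / d.τQ i * d.QθQ i j)
  | Sum.inr (Sum.inr _), Sum.inr (Sum.inl _) => 0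
  | Sum.inr (Sum.inr i), Sum.inr (Sum.inr j) => -(1 / d.τQ i * ((if i = j then 1 else 0) + d.kQ i * d.QVQ i j))

/-- `jacQ = jacQx` (the block products by diagonal matrices, unfolded). [folklore] -/
theorem jacQ_eq_jacQx : d.jacQ = d.jacQx := by
  ext a b
  rcases a with i | i | i <;> rcases b with j | j | j <;>
    simp [jacQ, jacQx, Matrix.fromBlocks, Matrix.fromCols, Matrix.fromRows,
      Matrix.one_apply, Matrix.diagonal_apply, Matrix.mul_add, Matrix.mul_apply]
  split_ifs <;> ring

end DroopQVData

/-! ## §2 Kernel-evaluable rows of `S(−J) + (S(−J))ᵀ − 2r₀S − δ·1` and their matrix semantics -/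

namespace DeflRows

/-- Rows with entry `(i, j) = −Σ_k S_ik J_kj − Σ_k S_jk J_ki − 2 r₀ S_ij − δ[i = j]` (`n × n`, from `List.finRange`; entries of `S`, `J`
read with `List.getD` exactly as `matrixOfRows` does). Computable; meant for kernel evaluation inside `decide`. [folklore] -/
def lyapRows (n : ℕ) (r₀ δ : ℚ) (S J : List (List ℚ)) : List (List ℚ) :=
  (List.finRange n).map fun i : Fin n => (List.finRange n).map fun j : Fin n =>
    -(((List.finRange n).map fun k : Fin n => (S.getD i.val []).getD k.val 0 * (J.getD k.val []).getD j.val 0).sum)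
      - (((List.finRange n).map fun k : Fin n => (S.getD j.val []).getD k.val 0 * (J.getD k.val []).getD i.val 0).sum)
      - 2 * r₀ * (S.getD i.val []).getD j.val 0 - (if i = j then δ else 0)

/-- Reading a `List.finRange`-indexed table with `List.getD`. [folklore] -/
theorem getD_map_finRange {α : Type*} {n : ℕ} (f : Fin n → α) (dflt : α) (i : Fin n) :
    ((List.finRange n).map f).getD i.val dflt = f i := by
  rw [List.getD_eq_getElem?_getD, List.getElem?_map]
  have hi : i.val < (List.finRange n).length := by simp
  rw [List.getElem?_eq_getElem hi]
  simp

/-- **Matrix semantics of `lyapRows`**: `matrixOfRows n n (lyapRows n r₀ δ S J) = M_S·(−M_J) + (M_S·(−M_J))ᵀ − (2r₀)·M_S − δ·1` with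
`M_X = matrixOfRows n n X`. [folklore] -/
theorem matrixOfRows_lyapRows (n : ℕ) (r₀ δ : ℚ) (S J : List (List ℚ)) :
    matrixOfRows n n (lyapRows n r₀ δ S J)
      = matrixOfRows n n S * (-matrixOfRows n n J) + (matrixOfRows n n S * (-matrixOfRows n n J))ᵀ
          - (2 * r₀) • matrixOfRows n n S - δ • (1 : Matrix (Fin n) (Fin n) ℚ) := by
  ext i j
  rw [matrixOfRows_apply, lyapRows, getD_map_finRange, getD_map_finRange]
  simp only [Matrix.add_apply, Matrix.sub_apply, Matrix.smul_apply, Matrix.transpose_apply, Matrix.mul_apply,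
    Matrix.neg_apply, Matrix.one_apply, matrixOfRows_apply, smul_eq_mul, ← Fin.sum_univ_def, mul_neg]
  split_ifs <;> ring

end DeflRows

end Summit.Ventures.GridStability.Models
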